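import Summits.QuantumFields.BalabanUV.T4Continuum.Spine.NE3.QbarTowerB8
import Summits.QuantumFields.BalabanUV.T4Continuum.Support.NE3FramePotBoundWClass
import Literature.MathematicalPhysics.QuantumFieldTheory.Balaban1983to89.B7AvgPeriodicity
import HarnessLib

/-!
# T⁴ programme, node NE3 — census R26′, step 2b-β (file 1∕2): interface lemmas for the ℓ² remainder tower — `shiftCfg` periodicity from the tree's
# coordinate periodicity, `l2sq` under unitary conjugation, `√l2sq` triangle over finite sums, peeling `LevelSmall`, and THE ℓ² CONTRACTION OF THE COMPOSED
# LINEAR PARTS FROM AN INTERMEDIATE BACKGROUND (`l2sq (linCovIter L W′ Y m) ≤ 4·(L²∕L^d)^m·l2sq Y`)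

Cell `pub-balaban-gaps` (YM blitz, track G2, seat `ne3`, unit `pub-balaban-gaps-ne3`; writer prover-pub-balaban-gaps-ne3-g4-0, 2026-08-23), census
`run/shared/lean/pub/pub-balaban-gaps/ne/NE3.md` §4 R26′ ∕ §10 F8.  Inputs BY NAME: `RemainderSumsStepB8.sum_normSq_Ccov_le` (step 1: one-step remainder in ℓ²),
`RemainderTelescopeB8.linCovIter_sub_logCovIter_eq_sum` (step 2a: telescoping), `RemainderTowerArith.tower_l2_induction`∕`tower_l2_total` (step 2b-α: bookkeeping),
`NE3FramePotBoundWClass.l2sq_QbarIter_le_class` (ℓ² contraction of the LINEAR tower), `QbarTowerB8.linCovIter_adField` (dictionary), `B7Eq123General.prop4_general` (ii)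
(sup tower), `B7Eq123General.level_data` (per-level background data), `B7AvgPeriodicity.logCovIter_periodic` (periodicity of the nonlinear iterates).

CONTENT (all [folklore]; 0 sorry; 0 def): §1 `shiftCfg_of_isPeriodicCfg`, `shiftCfg_of_isPeriodicDir`, `l2sq_adField`, `adField_inv`, `sqrt_l2sq_neg`, `sqrt_l2sq_finset_sum_le`,
`levelSmall_radIter`; §2 **`l2sq_linCovIter_le`**, **`sqrt_l2sq_linCovIter_le`** (dictionary `QbarTowerB8.linCovIter_adField` + `NE3FramePotBoundWClass.l2sq_QbarIter_le_class`).
File 2∕2 (`RemainderTowerB8`) assembles the tower.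

HONEST FRAMING.  Kinematics∕bookkeeping on OUR objects; NOTHING of Bałaban's is proved beyond printed-type one-step letters' consequences; **NE3 is NOT proved**; spine PROVED 0∕9; finite T⁴ rung (B)+1 — NOT continuum YM on ℝ⁴, NOT infinite
volume, NOT mass gap, NOT `BetaPertH`, NOT Clay.  PLACEMENT: `Summits/QuantumFields/BalabanUV/T4Continuum/Spine/NE3/`.
-/

set_option autoImplicit false

open scoped BigOperators Matrix.Norms.L2Operator
open NormedSpace Finset

namespace Summit.QuantumFields.BalabanUV.T4Continuum.NE3.RemainderTowerPrepB8

open Literature.MathematicalPhysics.QuantumFieldTheory.Balaban1983to89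
open B7Prop1Explicit B7Prop2Explicit B7Prop3Flat MatrixLog
open B7Prop3GeneralLinear (Ccov linQcov Qcov)
open B7Prop4GeneralLevels (logCovIter linCovIter)
open B7Eq123General (prop4_general level_data blockLoops_of_pdev dbavgCovIter_eq_expCfg_logCovIter)
open B7Eq92Concrete (dbavgCovIter)
open B12Ineq417Flat (shiftCfg shiftCfg_apply)
open B7AvgPeriodicity (periodic_of_coord logCovIter_periodic linCovIter_periodic Qcov_periodic)
open T4AveragingDeficitWall (IsSkewDir IsUnitaryCfg SmallField Ad dirSq)
open T4AveragingDeficitWallBoundary (IsPeriodicCfg periodBox)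
open AveragingDeficitPeriodicCounting (IsPeriodicDir)
open AveragingDeficitChartCalculus (cavg)
open AveragingDeficitMultiLevelPrep (cavgIter LevelSmall radIter tower cavgIter_unitary_small isPeriodicCfg_cavgIter)
open AveragingDeficitMultiLevelBridge (cavgIter_eq_avgIter)
open AveragingDeficitTransport (norm_Ad_of_unitary)
open AveragingDeficitNearIdentity (Ad_one)
open T4AveragingDeficitNonAbelian (Ad_mul)
open NE3TangentCovariantTower (QbarIter)
open NE3CovariantLineSumsL2 (l2sq l2sq_nonneg sqrt_l2sq_add_le)
open NE3FramePotBoundW (tower_eq_pow_mul levelSmall_of_le)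
open NE3FramePotBoundWClass (l2sq_QbarIter_le_class)
open NE3.QbarDictionary (adField)
open NE3.QbarTowerB8 (linCovIter_adField logCovIter_eq_zero_of_dbar)

noncomputable section

variable {d : ℕ} {n : Type*} [Fintype n] [DecidableEq n]

/-! ## §1 Interface lemmas -/

/-- Coordinate periodicity of a configuration as invariance under the whole period lattice (`shiftCfg` form). [folklore] -/
theorem shiftCfg_of_isPeriodicCfg {W : Site d → Fin d → (Matrix n n ℂ)ˣ} {P : ℤ} (hW : IsPeriodicCfg W P) :
    ∀ a : Site d, shiftCfg (P • a) W = W :=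
  periodic_of_coord fun i => by
    funext x μ
    rw [shiftCfg_apply]
    exact hW x i μ

omit [Fintype n] [DecidableEq n] in
/-- The same for a direction field. [folklore] -/
theorem shiftCfg_of_isPeriodicDir {Y : Site d → Fin d → Matrix n n ℂ} {P : ℤ} (hY : IsPeriodicDir Y P) :
    ∀ a : Site d, shiftCfg (P • a) Y = Y :=
  periodic_of_coord fun i => by
    funext x μ
    rw [shiftCfg_apply]
    exact hY x i μ

/-- `l2sq` is invariant under conjugation by a unitary configuration. [folklore] -/
theorem l2sq_adField {V : Site d → Fin d → (Matrix n n ℂ)ˣ} (hV : IsUnitaryCfg V) (F : Finset (Site d)) (Y : Site d → Fin d → Matrix n n ℂ) :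
    l2sq F (adField V Y) = l2sq F Y := by
  unfold l2sq adField
  refine Finset.sum_congr rfl fun z _ => Finset.sum_congr rfl fun κ _ => ?_
  rw [norm_Ad_of_unitary (hV z κ)]

/-- Undoing the conjugation: `adField V (fun x μ => Ad (V x μ)⁻¹ (Y x μ)) = Y`. [folklore] -/
theorem adField_inv (V : Site d → Fin d → (Matrix n n ℂ)ˣ) (Y : Site d → Fin d → Matrix n n ℂ) :
    adField V (fun x μ => Ad (V x μ)⁻¹ (Y x μ)) = Y := by
  funext x μ
  simp only [adField, ← Ad_mul, mul_inv_cancel, Ad_one]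

/-- `√l2sq` of a negated field. [folklore] -/
theorem sqrt_l2sq_neg (F : Finset (Site d)) (f : Site d → Fin d → Matrix n n ℂ) : l2sq F (-f) = l2sq F f := by
  unfold l2sq; simp

/-- **Triangle inequality for `√l2sq` over a finite sum of fields.** [folklore] -/
theorem sqrt_l2sq_finset_sum_le {ι : Type*} (s : Finset ι) (F : Finset (Site d)) (f : ι → Site d → Fin d → Matrix n n ℂ) :
    Real.sqrt (l2sq F (∑ i ∈ s, f i)) ≤ ∑ i ∈ s, Real.sqrt (l2sq F (f i)) := by
  classical
  induction s using Finset.induction_on with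
  | empty =>
      simp only [Finset.sum_empty]
      have : l2sq F (0 : Site d → Fin d → Matrix n n ℂ) = 0 := by unfold l2sq; simp
      rw [this, Real.sqrt_zero]
  | insert i s hi ih =>
      rw [Finset.sum_insert hi, Finset.sum_insert hi]
      have h := sqrt_l2sq_add_le F (f i) (∑ j ∈ s, f j)
      have e : (fun z κ => f i z κ + (∑ j ∈ s, f j) z κ) = f i + ∑ j ∈ s, f j := by
        funext z κ; simp [Finset.sum_apply]
      rw [e] at h
      exact h.trans (add_le_add le_rfl ih)

/-- Peeling levels off the multi-level smallness: `LevelSmall d L (i + j) x → LevelSmall d L j (radIter d L i x)`. [folklore] -/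
theorem levelSmall_radIter {L : ℕ} : ∀ (i j : ℕ) {x : ℝ}, LevelSmall d L (i + j) x → LevelSmall d L j (radIter d L i x)
  | 0, j, x, h => by rw [Nat.zero_add] at h; exact h
  | i + 1, j, x, h => by
      have h' : LevelSmall d L ((i + j) + 1) x := by rw [show i + 1 + j = (i + j) + 1 by omega] at h; exact h
      exact levelSmall_radIter i j h'.2

/-! ## §2 The ℓ² contraction of the composed linear parts from an intermediate background -/

/-- **THE COMPOSED LINEAR PARTS CONTRACT IN ℓ² ON THE TORUS** (through the dictionary `linCovIter W′ (Ad_{W′} Y′) = Ad (QbarIter W′ Y′)` and the tree's ℓ² tower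
`l2sq_QbarIter_le_class`): for a unitary `(L^m·P)`-periodic background `W′` of the class (`LevelSmall d L j′ x′`, `m ≤ j′+1`, `SmallField W′ x′`, block loops of its
averaged backgrounds within `1` of the unit below level `m`) and an `(L^m·P)`-periodic field `Y`:
`l2sq (periodBox P) (linCovIter L W′ Y m) ≤ 4·(L²∕L^d)^m·l2sq (periodBox (L^m·P)) Y`. [folklore] -/
theorem l2sq_linCovIter_le [Nonempty n] {L P : ℕ} (hL : 2 ≤ L) (hP : 1 ≤ P) {j' : ℕ} (m : ℕ) (hmj : m ≤ j' + 1)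
    {W' : Site d → Fin d → (Matrix n n ℂ)ˣ} {x' : ℝ} (hWu : IsUnitaryCfg W') (hWP : IsPeriodicCfg W' ((L ^ m * P : ℕ) : ℤ)) (hx : 0 ≤ x')
    (hsm : LevelSmall d L j' x') (hWx : SmallField W' x')
    (hloops : ∀ i < m, ∀ (z : Site d) (κ : Fin d) (r : Fin d → Fin L),
      ‖((Wcx L (cavgIter L i W') ((L : ℤ) • z) κ (boxVec L r) : (Matrix n n ℂ)ˣ) : Matrix n n ℂ) - 1‖ < 1)
    {Y : Site d → Fin d → Matrix n n ℂ} (hY : IsPeriodicDir Y ((L ^ m * P : ℕ) : ℤ)) :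
    l2sq (periodBox (d := d) P) (linCovIter L W' Y m) ≤ 4 * ((L : ℝ) ^ 2 / (L : ℝ) ^ d) ^ m * l2sq (periodBox (d := d) (L ^ m * P)) Y := by
  have hL1 : 1 ≤ L := by omega
  set Y' : Site d → Fin d → Matrix n n ℂ := fun x μ => Ad (W' x μ)⁻¹ (Y x μ) with hY'
  have hYY : Y = adField W' Y' := (adField_inv W' Y).symm
  have hY'P : IsPeriodicDir Y' ((L ^ m * P : ℕ) : ℤ) := by
    intro x i μ
    simp only [hY', hWP x i μ, hY x i μ]
  -- unitarity of the level-`m` averaged background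
  have hVu : IsUnitaryCfg (cavgIter L m W') := by
    cases m with
    | zero => exact hWu
    | succ m => exact (cavgIter_unitary_small hL1 m hWu hx (levelSmall_of_le (by omega) hsm) hWx).1
  rw [hYY, linCovIter_adField L W' Y' m hloops, l2sq_adField hVu, l2sq_adField hWu]
  exact l2sq_QbarIter_le_class hL hP m hmj hWu hWP hx hsm hWx hY'P

/-- The same in `√`-form: `√l2sq (linCovIter L W′ Y m) ≤ 2·ρ^m·√l2sq Y`, `ρ = √(L²∕L^d)`. [folklore] -/
theorem sqrt_l2sq_linCovIter_le [Nonempty n] {L P : ℕ} (hL : 2 ≤ L) (hP : 1 ≤ P) {j' : ℕ} (m : ℕ) (hmj : m ≤ j' + 1)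
    {W' : Site d → Fin d → (Matrix n n ℂ)ˣ} {x' : ℝ} (hWu : IsUnitaryCfg W') (hWP : IsPeriodicCfg W' ((L ^ m * P : ℕ) : ℤ)) (hx : 0 ≤ x')
    (hsm : LevelSmall d L j' x') (hWx : SmallField W' x')
    (hloops : ∀ i < m, ∀ (z : Site d) (κ : Fin d) (r : Fin d → Fin L),
      ‖((Wcx L (cavgIter L i W') ((L : ℤ) • z) κ (boxVec L r) : (Matrix n n ℂ)ˣ) : Matrix n n ℂ) - 1‖ < 1)
    {Y : Site d → Fin d → Matrix n n ℂ} (hY : IsPeriodicDir Y ((L ^ m * P : ℕ) : ℤ)) :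
    Real.sqrt (l2sq (periodBox (d := d) P) (linCovIter L W' Y m))
      ≤ 2 * Real.sqrt ((L : ℝ) ^ 2 / (L : ℝ) ^ d) ^ m * Real.sqrt (l2sq (periodBox (d := d) (L ^ m * P)) Y) := by
  have h := l2sq_linCovIter_le hL hP m hmj hWu hWP hx hsm hWx hloops hY
  have hρ0 : 0 ≤ (L : ℝ) ^ 2 / (L : ℝ) ^ d := by positivity
  calc Real.sqrt (l2sq (periodBox (d := d) P) (linCovIter L W' Y m))
      ≤ Real.sqrt (4 * ((L : ℝ) ^ 2 / (L : ℝ) ^ d) ^ m * l2sq (periodBox (d := d) (L ^ m * P)) Y) := Real.sqrt_le_sqrt h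
    _ = 2 * Real.sqrt ((L : ℝ) ^ 2 / (L : ℝ) ^ d) ^ m * Real.sqrt (l2sq (periodBox (d := d) (L ^ m * P)) Y) := by
        have e4 : Real.sqrt (4 : ℝ) = 2 := by
          rw [show (4 : ℝ) = 2 ^ 2 by norm_num, Real.sqrt_sq (by norm_num)]
        have ep : Real.sqrt (((L : ℝ) ^ 2 / (L : ℝ) ^ d) ^ m) = Real.sqrt ((L : ℝ) ^ 2 / (L : ℝ) ^ d) ^ m := by
          have e : ((L : ℝ) ^ 2 / (L : ℝ) ^ d) ^ m = (Real.sqrt ((L : ℝ) ^ 2 / (L : ℝ) ^ d) ^ m) ^ 2 := by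
            rw [← pow_mul, mul_comm, pow_mul, Real.sq_sqrt hρ0]
          rw [e, Real.sqrt_sq (pow_nonneg (Real.sqrt_nonneg _) _)]
        rw [Real.sqrt_mul (by positivity), Real.sqrt_mul (by norm_num), e4, ep]

end

end Summit.QuantumFields.BalabanUV.T4Continuum.NE3.RemainderTowerPrepB8
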